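import Summits.Ventures.PercRepro.GenQTraceLarge
import Summits.Ventures.PercRepro.GenQLargeSevenBase
import Summits.Ventures.PercRepro.GenQCoreChain
import Summits.Ventures.PercRepro.GenQTraceSevenBase

/-!
# PercRepro — TRACE LARGE at level `8` (`TraceSumsCore 7`): `μ₇` for the core chain (night-4, gen 18)

The level-`8` trace sums of the `(10, 8)` cell live on the rank-`7` subsets `H` of the core (`|H| ≤ fCore 7 = 87`).
`mu7 = 7, 5, 4, 3, 2, 1, 0` on `j ≤ 7, = 8, ≤ 10, ≤ 13, ≤ 23, ≤ 44, ≥ 45` (`GenQLargeSevenBase`) is also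
`muQ 7 fCore` (`muQ_seven_core`, by `decide` up to `44` and `muQ_eq_zero_of_forall` beyond — `fCore` and `fSeven`
agree below rank `7`).  The numerics `0 ≤ lbSumT 7 fCore t n` (`1 ≤ t ≤ 7`, `traceSevenBound t ≤ n ≤ 87`) are
`GenQTraceEightNumA … F`; the reduction of `TraceSumsCore 7` to its certificate residue is `GenQTraceEightAll`.
Imports `GenQTraceLarge`, `GenQLargeSevenBase`, `GenQCoreChain`, `GenQTraceSevenBase` (`fCore_five`).
-/
namespace PercRepro.Night4

open Finset ThmH SixFour GenQ PerFlat Star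

/-- **`muQ 7 fCore j = μ₇(j)`** at every `j`. -/
theorem muQ_seven_core (j : ℕ) : muQ 7 fCore j = mu7 j := by
  by_cases hj : j ≤ 44
  · interval_cases j <;> decide
  · rw [muQ_eq_zero_of_forall (by omega)]
    · unfold mu7
      simp only [show ¬ j ≤ 7 by omega, show ¬ j ≤ 8 by omega, show ¬ j ≤ 10 by omega, show ¬ j ≤ 13 by omega,
        show ¬ j ≤ 23 by omega, show ¬ j ≤ 44 by omega, if_false]
    · intro m hm1 hm2
      interval_cases m <;> simp [fCore] <;> omega

/-- The corank window of the trace residue at level `8`, type `t`: `|H| < 30 / 30 / 32 / 34 / 38 / 47 / 83` at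
`t = 1 … 7` (the first `n` with `0 ≤ lbSumT 7 fCore t n`; exact rationals, two implementations). -/
def traceSevenBound (t : ℕ) : ℕ :=
  if t ≤ 1 then 30 else if t ≤ 2 then 30 else if t ≤ 3 then 32 else if t ≤ 4 then 34 else if t ≤ 5 then 38
  else if t ≤ 6 then 47 else 83

end PercRepro.Night4
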